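import Mathlib
import Summits.NavierStokesRegularity.NavierStokesRegularity.Theorems.EulerZoomLiouvillePowerGaugeEulerLiouvilleCondenserWindowSummabilityProfile
import Summits.NavierStokesRegularity.NavierStokesRegularity.Theorems.EulerZoomLiouvillePowerGaugeEulerLiouvilleCondenserInfiniteTypePast

/-!
# THEOREM K^Σ′ — PAST-EXACT TWIN (plate t50-KΣ′-PAST, nsreg-p2 g37 key 01:14:10Z; split with ns-sfl-p1 g7 per 01:15:29Z)

Width piece for crux `EulerZoomLiouville.PowerGaugeEulerLiouville` (stmt-NavierStokesRegularity-19832), by name under LEAD 19832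
(ns-typeII-p2 g14) and planner nsreg-p2 g37; seat ns-ezl-w2 g5, `--supports stmt-NavierStokesRegularity-19832 --as helper`.

* `sq_budget_all_radii` — a class-free patch: an `A`-budget `∫_{B(0,r)}‖V‖² ≤ C_A r^{1−2ρ}` for `r ≥ 1` of a CONTINUOUS field extends
  to ALL `r > 0` with a larger constant (on `B(0,r)`, `r ≤ 1`: `∫ ≤ sup_{B̄(0,1)}‖V‖²·vol B(0,r) = M v₁ r³ ≤ M v₁ r^{1−2ρ}`); needed because
  ns-sfl-p1 g7's profile-level core `Condenser.curl_eq_zero_of_windowDivergent` (p685371) takes the budget at every `r > 0` while the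
  PAST budgets `NeedleRace.needleBudgets_of_selfSimilarC2_past` deliver radii `≥ 1` only.
* `windowSummabilityLiouville_past_of_weight` — the PAST-EXACT twin of K^Σ′ (`Condenser.windowSummabilityLiouville`, p685210) in the
  shape of ns-ezl-w3 g6's T-M(a) `Condenser.selfSimilar_ae_eq_zero_of_finiteTypeGradientC2_past_of_weight` (`…CondenserInfiniteTypePast`):
  crux binders verbatim, exact self-similarity about `(T, x₀)` for `τ < T₁` (`T₁ ≤ 0`, `T₁ ≤ T`), `V ∈ C²`, the weighted dissipation
  integral as a HYPOTHESIS `hEw` (see that file's docstring for why it is not derivable from the gauges when `T₁ < T`), and a divergent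
  window family (`q > 1`, `qℓ_k ≤ ℓ_{k+1}`, envelopes `exp(G_k)` on `B(0,qℓ_k)`, `G_k ≥ 1`, `Σ_k ℓ_k^{2+ρ}/G_k = ∞`) ⇒ `u = 0` a.e. on
  `(−∞,0) × ℝ³`.  Proof: classical pressure `Past.exists_isSelfSimilarEulerProfile`, `A`-budget in O-form from the far past + the patch, the
  core BY NAME, and the past irrotational kill `Past.selfSimilar_ae_eq_zero_of_irrotationalC2_profile`.

HONEST FRAMING: a stratum statement about HYPOTHETICAL past-exactly self-similar `C²` members of crux E's class (MODEL lattice); nothing here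
proves the crux E (19832 OPEN), any door Target, or Navier–Stokes regularity. [nsreg-p2 ROUND-47 v1.3 THEOREM K^Σ′; cite:
ConstantinIgnatovaVicol2026Putative, §3.4.1; folklore (length–area method)]
-/

noncomputable section

open Set Filter Topology Metric Function MeasureTheory Real
open scoped RealInnerProductSpace NNReal ENNReal

set_option linter.dupNamespace false

namespace Summit.NavierStokesRegularity.NavierStokesRegularity.Theorems.PowerGaugeEulerLiouville.Condenser

open Literature.Analysis Literature.Analysis.FluidPDE
open Summit.NavierStokesRegularity.NavierStokesRegularity.Theorems.PowerGaugeEulerLiouville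

/-- **All-radii patch of a power energy budget.**  If `V : ℝ³ → ℝ³` is continuous, `1 − 2ρ ≤ 3`, and
`∫_{B(0,r)}‖V‖² ≤ C_A r^{1−2ρ}` for all `r ≥ 1`, then for some `C_A′ ≥ C_A`, `C_A′ > 0`: `∫_{B(0,r)}‖V‖² ≤ C_A′ r^{1−2ρ}` for ALL `r > 0`
(small balls: `sup_{B̄(0,1)}‖V‖² · vol B(0,1) · r³` and `r³ ≤ r^{1−2ρ}` for `r ≤ 1`). [folklore] -/
theorem sq_budget_all_radii {V : EuclideanSpace ℝ (Fin 3) → EuclideanSpace ℝ (Fin 3)} (hVc : Continuous V) {ρ CA : ℝ}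
    (hρ : 1 - 2 * ρ ≤ 3) (hCA : 0 < CA)
    (hbA : ∀ r : ℝ, 1 ≤ r → ∫ x in ball (0 : EuclideanSpace ℝ (Fin 3)) r, ‖V x‖ ^ 2 ≤ CA * r ^ (1 - 2 * ρ)) :
    ∃ CA' : ℝ, 0 < CA' ∧
      ∀ r : ℝ, 0 < r → ∫ x in ball (0 : EuclideanSpace ℝ (Fin 3)) r, ‖V x‖ ^ 2 ≤ CA' * r ^ (1 - 2 * ρ) := by
  -- a bound for `‖V‖²` on the closed unit ball
  have hc2 : Continuous fun x => ‖V x‖ ^ 2 := by fun_prop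
  obtain ⟨M, hM⟩ := (isCompact_closedBall (0 : EuclideanSpace ℝ (Fin 3)) 1).exists_bound_of_continuousOn hc2.continuousOn
  have hM' : ∀ x ∈ closedBall (0 : EuclideanSpace ℝ (Fin 3)) 1, ‖V x‖ ^ 2 ≤ M := fun x hx => by
    have h := hM x hx
    rw [Real.norm_eq_abs] at h
    exact (le_abs_self _).trans h
  have hM0 : 0 ≤ M := le_trans (sq_nonneg ‖V 0‖) (hM' 0 (mem_closedBall_self zero_le_one))
  set v₁ : ℝ := (volume (ball (0 : EuclideanSpace ℝ (Fin 3)) 1)).toReal with hv₁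
  have hv₁0 : 0 ≤ v₁ := ENNReal.toReal_nonneg
  refine ⟨CA + M * v₁, by positivity, fun r hr => ?_⟩
  rcases le_or_gt 1 r with h1 | h1
  · calc ∫ x in ball (0 : EuclideanSpace ℝ (Fin 3)) r, ‖V x‖ ^ 2 ≤ CA * r ^ (1 - 2 * ρ) := hbA r h1
      _ ≤ (CA + M * v₁) * r ^ (1 - 2 * ρ) := by
          have : 0 ≤ M * v₁ * r ^ (1 - 2 * ρ) := by positivity
          nlinarith
  · -- small balls
    have hsub : ball (0 : EuclideanSpace ℝ (Fin 3)) r ⊆ closedBall 0 1 :=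
      ball_subset_closedBall.trans (closedBall_subset_closedBall h1.le)
    have hfi : IntegrableOn (fun x => ‖V x‖ ^ 2) (ball (0 : EuclideanSpace ℝ (Fin 3)) r) volume :=
      (hc2.continuousOn.integrableOn_compact (isCompact_closedBall 0 1)).mono_set hsub
    have hvol : (volume (ball (0 : EuclideanSpace ℝ (Fin 3)) r)).toReal = r ^ 3 * v₁ := by
      rw [Measure.addHaar_ball volume 0 hr.le, finrank_euclideanSpace_fin, ENNReal.toReal_mul,
        ENNReal.toReal_ofReal (by positivity), hv₁]
    have hI : ∫ x in ball (0 : EuclideanSpace ℝ (Fin 3)) r, ‖V x‖ ^ 2 ≤ M * (r ^ 3 * v₁) := by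
      calc ∫ x in ball (0 : EuclideanSpace ℝ (Fin 3)) r, ‖V x‖ ^ 2
          ≤ ∫ x in ball (0 : EuclideanSpace ℝ (Fin 3)) r, M :=
            setIntegral_mono_on hfi (integrableOn_const (hs := measure_ball_lt_top.ne)) measurableSet_ball
              fun x hx => hM' x (hsub hx)
        _ = M * (r ^ 3 * v₁) := by rw [setIntegral_const, measureReal_def, hvol, smul_eq_mul, mul_comm]
    have hr3 : r ^ 3 ≤ r ^ (1 - 2 * ρ) := by
      rw [show r ^ 3 = r ^ (3 : ℝ) by norm_cast]
      exact Real.rpow_le_rpow_of_exponent_ge hr h1.le hρ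
    calc ∫ x in ball (0 : EuclideanSpace ℝ (Fin 3)) r, ‖V x‖ ^ 2 ≤ M * (r ^ 3 * v₁) := hI
      _ = M * v₁ * r ^ 3 := by ring
      _ ≤ M * v₁ * r ^ (1 - 2 * ρ) := mul_le_mul_of_nonneg_left hr3 (by positivity)
      _ ≤ (CA + M * v₁) * r ^ (1 - 2 * ρ) := by
          have : 0 ≤ CA * r ^ (1 - 2 * ρ) := by positivity
          nlinarith

/-- **THEOREM K^Σ′ — PAST-EXACT TWIN (plate t50-KΣ′-PAST), conditional on the weighted dissipation integral `hEw`.**  Crux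
hypotheses verbatim (`0 < ρ ≤ ½`) + exact self-similarity about `(T, x₀)` for `τ < T₁` (`T₁ ≤ 0`, `T₁ ≤ T`) + `V ∈ C²` +
`∫⁻ ‖DV‖ₑ²‖y‖^{ρ−1} ≤ E` + a family of pairwise disjoint windows `[ℓ_k, qℓ_k)` (`q > 1`, `qℓ_k ≤ ℓ_{k+1}`) with envelopes
`‖DV‖ ≤ exp(G_k)` on `B(0,qℓ_k)`, `G_k ≥ 1`, and `Σ_k ℓ_k^{2+ρ}/G_k = ∞` ⇒ `u = 0` a.e. on `(−∞,0) × ℝ³`.  Contains T-M(a)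
(`G_k = C(qℓ_k)^{2+ρ}` along a `q`-separated sequence). [nsreg-p2 ROUND-47 v1.3 THEOREM K^Σ′; cite: ConstantinIgnatovaVicol2026Putative,
§3.4.1; folklore (length–area method)] -/
theorem windowSummabilityLiouville_past_of_weight {ρ T T₁ : ℝ} (hρ : 0 < ρ) (hρ1 : ρ ≤ 1 / 2)
    (hT₁ : T₁ ≤ 0) (hTT₁ : T₁ ≤ T) (x₀ : EuclideanSpace ℝ (Fin 3))
    {u : ℝ → EuclideanSpace ℝ (Fin 3) → EuclideanSpace ℝ (Fin 3)} {p : ℝ → EuclideanSpace ℝ (Fin 3) → ℝ}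
    {H : ℝ → EuclideanSpace ℝ (Fin 3) → EuclideanSpace ℝ (Fin 3) →L[ℝ] EuclideanSpace ℝ (Fin 3)} {c : ℝ≥0}
    (hsw : IsSuitableWeakSolutionOn (slab (EuclideanSpace ℝ (Fin 3)) (Iio 0) isOpen_Iio) 0 0 u p)
    (hH : HasWeakSpatialGradientOn (slab (EuclideanSpace ℝ (Fin 3)) (Iio 0) isOpen_Iio) u H)
    (hgauge : ∀ a : ℝ, 0 < a →
      ENNReal.ofReal (a ^ (2 * ρ)) * cknA a (0 : ℝ × EuclideanSpace ℝ (Fin 3)) u +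
          ENNReal.ofReal (a ^ ρ) * cknE a (0 : ℝ × EuclideanSpace ℝ (Fin 3)) H +
        ENNReal.ofReal (a ^ (2 * ρ)) * cknD a (0 : ℝ × EuclideanSpace ℝ (Fin 3)) p ≤ (c : ℝ≥0∞))
    {V : EuclideanSpace ℝ (Fin 3) → EuclideanSpace ℝ (Fin 3)} {P : EuclideanSpace ℝ (Fin 3) → ℝ}
    (hu : ∀ τ : ℝ, τ < T₁ → u τ = fun x => selfSimilarCollapse (1 / (2 + ρ)) T V τ (x - x₀))
    (hp : ∀ τ : ℝ, τ < T₁ → p τ = fun x => selfSimilarCollapsePressure (1 / (2 + ρ)) T P τ (x - x₀))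
    (hV : ContDiff ℝ 2 V) {E : ℝ}
    (hEw : ∫⁻ y, ‖fderiv ℝ V y‖ₑ ^ 2 * ENNReal.ofReal (‖y‖ ^ (ρ - 1)) ≤ ENNReal.ofReal E)
    {q : ℝ} {ℓ G : ℕ → ℝ} (hq : 1 < q) (hℓpos : ∀ k : ℕ, 0 < ℓ k) (hsep : ∀ k : ℕ, q * ℓ k ≤ ℓ (k + 1))
    (hG1 : ∀ k : ℕ, 1 ≤ G k)
    (henv : ∀ k : ℕ, ∀ z ∈ ball (0 : EuclideanSpace ℝ (Fin 3)) (q * ℓ k), ‖fderiv ℝ V z‖ ≤ Real.exp (G k))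
    (hdiv : ¬ Summable (fun k : ℕ => ℓ k ^ (2 + ρ) / G k)) :
    uncurry u =ᵐ[volume.restrict (Iio (0 : ℝ) ×ˢ (univ : Set (EuclideanSpace ℝ (Fin 3))))] 0 := by
  -- ### a classical pressure for the profile (far-past extension)
  obtain ⟨P', hprof⟩ := Past.exists_isSelfSimilarEulerProfile hρ hT₁ hTT₁ hsw.distributional hu hp hV
  -- ### the `A`-budget of the profile in O-form from the far past (radii `≥ 1`), patched to all radii
  have hA : ∀ a : ℝ, 0 < a → ENNReal.ofReal (a ^ (2 * ρ)) *
      cknA a (0 : ℝ × EuclideanSpace ℝ (Fin 3)) u ≤ (c : ℝ≥0∞) :=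
    fun a ha => le_trans (le_trans le_self_add le_self_add) (hgauge a ha)
  have hE : ∀ a : ℝ, 0 < a → ENNReal.ofReal (a ^ ρ) *
      cknE a (0 : ℝ × EuclideanSpace ℝ (Fin 3)) H ≤ (c : ℝ≥0∞) :=
    fun a ha => le_trans (le_trans le_add_self le_self_add) (hgauge a ha)
  obtain ⟨-, cA, cE, hcA, -, hbA', -⟩ :=
    NeedleRace.needleBudgets_of_selfSimilarC2_past hρ hρ1 hT₁ hTT₁ x₀ hsw.distributional hH hA hE hu hp hV
  have hCApos : 0 < cA + 1 := by linarith
  have hbA1 : ∀ r : ℝ, 1 ≤ r →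
      ∫ x in ball (0 : EuclideanSpace ℝ (Fin 3)) r, ‖V x‖ ^ 2 ≤ (cA + 1) * r ^ (1 - 2 * ρ) := by
    intro r hr
    have hr0 : (0 : ℝ) < r := by linarith
    have hX : 0 ≤ (cA + 1) * r ^ (1 - 2 * ρ) := by positivity
    refine setIntegral_sq_le_of_lintegral hV.continuous hX
      (((lintegral_mono_set ball_subset_closedBall).trans (hbA' r hr)).trans ?_)
    exact ENNReal.ofReal_le_ofReal (mul_le_mul_of_nonneg_right (by linarith) (Real.rpow_nonneg hr0.le _))
  obtain ⟨CA, hCA, hbA⟩ := sq_budget_all_radii hV.continuous (by linarith) hCApos hbA1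
  -- ### WLOG `E ≥ 0`
  have hEw' : ∫⁻ y, ‖fderiv ℝ V y‖ₑ ^ 2 * ENNReal.ofReal (‖y‖ ^ (ρ - 1)) ≤ ENNReal.ofReal (max E 0) :=
    hEw.trans (ENNReal.ofReal_le_ofReal (le_max_left _ _))
  -- ### the profile-level core (ns-sfl-p1 g7): the profile is irrotational; conclusion by the past irrotational kill
  have hcurl : ∀ x : EuclideanSpace ℝ (Fin 3), curl V x = 0 :=
    curl_eq_zero_of_windowDivergent hρ hρ1 hprof hV hCA hbA (le_max_right _ _) hEw' hq hℓpos hsep hG1 henv hdiv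
  exact Past.selfSimilar_ae_eq_zero_of_irrotationalC2_profile hρ hρ1 hT₁ hTT₁ x₀ hsw hH hgauge hu hp hV hcurl

end Summit.NavierStokesRegularity.NavierStokesRegularity.Theorems.PowerGaugeEulerLiouville.Condenser

end
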